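import Literature.MathematicalPhysics.QuantumFieldTheory.Balaban1983to89.B6Prop22MultiLevelTorusL0
import Literature.MathematicalPhysics.QuantumFieldTheory.Balaban1983to89.B6Prop22LapMultiLevelBoxL0
import Literature.MathematicalPhysics.QuantumFieldTheory.Balaban1983to89.B6Prop22LapMultiLevelTorus
/-!
# `Balaban1983to89.B6Prop22LapMultiLevelTorusL0` — LEVEL-0 TWIN (programme G-F3′-L0, director-ym LINE №27 / UV3-NODE §24.5; plan `lit-balaban-r03/G-F3L0-PLAN.md`) of `B6Prop22LapMultiLevelTorus`:
the same declarations, SAME NAMES AND STATEMENTS, for nested families WITH print's region `Λ₀ = T ∖ Ω₁` ADMITTED (structures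
`B6MultiLevelBoxOperatorL0.Domains` / `B6MultiLevelTorusOperatorL0.TDomains`: levels `0, …, k`, the level-`0` block a single site, `Q′₀ = id`,
finite weight `a₀` — print p.225 (2.14) «Σ_{j=0}^k … (Q′₀λ)(x) = λ(x), x ∈ Λ₀», p.229 «taking a sequence (2.1) … smallest possible domains B^j(Λ_j),
and considering the operator Δ_a defined by (2.19), (2.20) for this sequence»).  Every `D`-free object is the lineage's, consumed BY NAME; no existing
module is touched; no fact is minted.  Unit `lit-balaban-p33` (S-B hands, p33 gen 87; packet S-B owner p21 gen 26; port tooling by r03 gen 36); B6 fold owner r03; referee ref-4.  THE TWIN'S DOCUMENTATION FOLLOWS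
VERBATIM (its «levels 1 … k» / «Ω₁ = X» sentences describe the twin; here `j` runs from `0` and `Ω₁` may be a proper subset).

# `Balaban1983to89.B6Prop22LapMultiLevelTorus` — [B6] PROPOSITION 2.2, SIXTH ENTRY OF (2.67) (`|Δ^ηG′λ|`), FOR THE
GENUINE `k`-LEVEL OPERATOR `G′ = Δ′_a^{−1}` ON THE TORUS `T_η`: `|(Δ^ηG′λ)(x)| ≤ O(1)·e^{−½δ₀d(y,y′)}|λ|`, `x ∈ B^j(y)`,
`supp λ ⊂ B^{j′}(y′)` — from the first entry on the torus (file T4) and the algebra `−Δ_T G′ = 1 − Q′*aQ′G′` of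
(2.13)–(2.14) with the PERIODIC Laplacian (file T5 of the torus carrier of the multi-level parametrix; no existing module
is touched; no fact is minted)

FRAMING (verbatim cell line):
statement-level skeleton of published theorems with citation tags; proofs where landed; nothing here is a claim about the Yang–Mills mass gap

Source under audit (cell pub-balaban / lit-balaban): T. Bałaban, *Propagators and renormalization transformations for
lattice gauge theories. II*, Commun. Math. Phys. **96** (1984) 223–250 [`Balaban1984PropagatorsII`, "B6"], p. 225 [PDF 3]
(2.13)–(2.14), p. 234 [PDF 12] (2.67), Proposition 2.2 (held text `paper:balaban1984-cmp96-propagators-rt-ii`, p0003/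
p0012).  Unit `lit-balaban-p21` (Phase-2 proof seat p21 gen 15), HOME `run/shared/lean/pub/lit-balaban/`, B6 fold owner r03,
referee ref-4.  Box sibling (consumed BY NAME, untouched): `B6Prop22LapMultiLevelBox` (p21 gen 10: `vOp`, `vOp_apply`,
`vOp_mulVec_abs_le`, `prop22_sixth_multiLevelBox`).

## WHAT IS PRINTED (p. 234 and p. 225, verbatim up to notation; the operator reading of (2.14) is stated separately below)

p. 234: «**Proposition 2.2.** If we have (2.1), (2.2) and M is sufficiently large, then the operator G′ = Δ′_a^{−1}
(a = 1) satisfies the inequalities |(G′λ)(x)|, …, |(Δ^ηG′λ)(x)| ≤ O(1)[(L^jη)², …, 1]·e^{−½δ₀d(y,y′)}|λ|,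
x ∈ B^j(y) …, y ∈ Λ_j, supp λ ⊂ B^{j′}(y′), y′ ∈ Λ_{j′}. (2.67)» (sixth entry: the factor «1»).  p. 225:
«… where Δ′_a = Δ + Q′*aQ′ and the operator Q′*aQ′ is given by the quadratic form ⟨λ, Q′*aQ′λ⟩ =
Σ_{j=0}^{k} Σ_{y∈Λ_j} a_j(L^jη)^{d−2}|(Q′_jλ)(y)|². (2.14)».

OUR READING of (2.13)–(2.14) (not a quotation): as an operator, `Δ′_a = Σ_{j} a_j(L^jη)^{−2}Q′_j*Q′_j + (−Δ^η)` with
`−Δ^η` the positive lattice Laplacian of `Ω₁`; here `Ω₁ = T_η`, so the Laplacian is the periodic one (file T1's `perLapT`).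

## WHAT THIS FILE CERTIFIES (kernel-checked; setting of files T1–T4)

For the genuine operator `Δ′_a = mlOpT` of a nested family `D : TDomains d ℓ M_h k P R` on the torus and `G′ = gmlT`:
* §1 **`−Δ_T = Δ′_a − Q′*aQ′`** on the torus (`perLapT_eq_mlOpT_sub`: the averaging part `vOp` of the box lineage is
  the same matrix, the Laplacian is the periodic `perLapT` of file T1) and **`(−Δ_T)G′ = 1 − Q′*aQ′G′`**
  (`perLapT_mul_gmlT`, from `Δ′_aG′ = 1` with positivity of the weights at levels `≥ 1`);
* §2 **PROPOSITION 2.2, SIXTH ENTRY, ON THE TORUS** `prop22_sixth_multiLevelTorus`: there are `δ₀, C, M₀ > 0` and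
  `N₀` (functions of `d`, `ℓ`, windows — not of the torus) such that for every `k`, `M_h ≥ 3` with `L·M_h ≥ M₀`,
  `R ≥ 2L` with `RM ≥ N₀ + 1`, torus size `P` (`P_μ ≥ 4`), nested family `D` of domains of the torus and weights in the
  windows with `a_{i+1} = aNext ℓ a_i c_i`: `|((−Δ_T)G′λ)(x)| ≤ C·e^{−½δ₀d_T(y,y′)}|λ|` for `x ∈ B^j(y)`,
  `supp λ ⊂ B^{j′}(y′)` — the source term `λ(x)` (`d_T(y′,y′) = 0`) plus `Q′*aQ′G′λ`, which at a level-`j` site averages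
  `G′λ` over the `j`-block of `x` inside the torus block `y(x)` (the box lineage's `vOp_mulVec_abs_le` on `D.toDomains`),
  so the first entry `C·L^{2j}e^{−½δ₀d_T}` (file T4) times `a_j(L^j)^{−2}` gives `a₊C·e^{−½δ₀d_T}`.

## HONEST SCOPE

As files T1–T4: levels `1 … k` with `Ω₁ = T_η`, `m² = 0`, `M_h ≥ 3`, `P_μ ≥ 4`; lattice units (`G′` here is `η^{−2}G′`
of print and `Δ^1 = η²Δ^η`, so the factor is «1»); constants existential (functions of `d`, `ℓ`, windows).  Nothing is
inferred from the manuscript: every step is kernel-checked.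

DOCFIX (referee ref-4 NOTE S-B6-g55-1, «Gen 55»): the (2.14) display is quoted as printed (prose + quadratic form, p. 225);
the operator identity is marked as our reading, outside the verbatim scope; no declaration changed.
-/

namespace Literature.MathematicalPhysics.QuantumFieldTheory.Balaban1983to89.B6Prop22LapMultiLevelTorusL0

open Finset Matrix
open Literature.MathematicalPhysics.QuantumFieldTheory.Balaban1983to89.B4Reflection242 (boxDom mem_boxDom blk)
open Literature.MathematicalPhysics.QuantumFieldTheory.Balaban1983to89.B4BoxCov237 (opBoxR)
open Literature.MathematicalPhysics.QuantumFieldTheory.Balaban1983to89.B6Ineq243TwoLevelBox (aNext)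
open Literature.MathematicalPhysics.QuantumFieldTheory.Balaban1983to89.B6MultiLevelBoxOperator hiding Domains mlOp_apply
open Literature.MathematicalPhysics.QuantumFieldTheory.Balaban1983to89.B6MultiLevelBoxOperatorL0
open Literature.MathematicalPhysics.QuantumFieldTheory.Balaban1983to89.B6Geom246MultiLevelBox hiding Touch blkOf blkOf_corner blkOf_eq_iff_blk blkOf_eq_of_blk_i_eq blkOf_val bond bond_adj bset cen connected coord_bounds corner corner_mem csys dist_blkOf_le_box dist_blkOf_le_coord dist_blkOf_le_line dist_cen_le_of_adj dist_cen_le_of_touch dist_le_one_of_near dist_toR_cen_le exists_blkOf_eq geom lemma21_box lev_corner lev_eq_of_blkOf_eq levelGap pack reachable_blkOf reachable_of_near realizes scale_bounds touch_symm triangle_refl_nonneg walk_disp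
open Literature.MathematicalPhysics.QuantumFieldTheory.Balaban1983to89.B6Geom246MultiLevelBoxL0
open Literature.MathematicalPhysics.QuantumFieldTheory.Balaban1983to89.B6Prop22LapMultiLevelBox (vOp)
open Literature.MathematicalPhysics.QuantumFieldTheory.Balaban1983to89.B6Prop22LapMultiLevelBoxL0 (vOp_apply vOp_mulVec_abs_le)
open Literature.MathematicalPhysics.QuantumFieldTheory.Balaban1983to89.B6RandomWalk (HasMajorant BlockSupp
  hasMajorant_mono)
open Literature.MathematicalPhysics.QuantumFieldTheory.Balaban1983to89.B6MultiLevelTorusOperator hiding TDomains mlOpT_apply mlOpT_eq_reindex_chart mlOpT_mul_reindex mlOpT_tshift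
open Literature.MathematicalPhysics.QuantumFieldTheory.Balaban1983to89.B6MultiLevelTorusOperatorL0
open Literature.MathematicalPhysics.QuantumFieldTheory.Balaban1983to89.B6Geom246MultiLevelTorus hiding TouchT blkHom blkMap blkMap_blkOf blkMap_injective blkMap_surjective blkOf_tshift_eq bondT bondT_adj bond_le_bondT connectedT csysT distT_le_dist_box distT_le_dist_chart dist_posT_le_of_adj dist_posT_le_of_touchT dist_site_posT_le geomT label_bounds lemma21_torus levelGapT packT posT realizesT touchT_symm triangle_refl_nonneg_T walk_dispT
open Literature.MathematicalPhysics.QuantumFieldTheory.Balaban1983to89.B6Geom246MultiLevelTorusL0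
open Literature.MathematicalPhysics.QuantumFieldTheory.Balaban1983to89.B6Prop22MultiLevelTorus hiding blockSupp_chart distT_blkOf_le_chart fixedPoint_gmlT gZeroT_majorant keyT_injective mem_keySet_of_aT_ne_zero mem_keySet_of_bT_ne_zero prop22_first_multiLevelTorus rT_majorant
open Literature.MathematicalPhysics.QuantumFieldTheory.Balaban1983to89.B6Prop22MultiLevelTorusL0
open Literature.MathematicalPhysics.QuantumFieldTheory.Balaban1983to89.B6Prop22LapMultiLevelTorus (perLapT_eq_mlOpT_sub)

noncomputable section

variable {d : ℕ}

/-! ## §1 `−Δ_T = Δ′_a − Q′*aQ′` and `(−Δ_T)G′ = 1 − Q′*aQ′G′` on the torus -/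

section Averaging

variable {ℓ Mh k R : ℕ} {P : Fin (d + 1) → ℕ}

/-- **`(−Δ_T)G′ = 1 − Q′*aQ′G′`** for the genuine operator on the torus (`Δ′_aG′ = 1`, weights positive at levels `≥ 1`).
[cite: Balaban1984PropagatorsII, (2.13)–(2.14) p.225, (2.67) p.234 (sixth entry)] -/
theorem perLapT_mul_gmlT (D : TDomains d ℓ Mh k P R) {a : ℕ → ℝ} (hP : ∀ μ, 1 ≤ P μ) (hMh : 1 ≤ Mh)
    (ha : ∀ j, 0 < a j) :
    perLapT (N0 ℓ Mh k P) * gmlT (N0 ℓ Mh k P) ℓ k D.lev a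
      = 1 - vOp (N0 ℓ Mh k P) ℓ k D.lev a * gmlT (N0 ℓ Mh k P) ℓ k D.lev a := by
  have hGE : gmlT (N0 ℓ Mh k P) ℓ k D.lev a * mlOpT (N0 ℓ Mh k P) ℓ k D.lev a = 1 :=
    gmlT_mul_mlOpT (one_le_N0 hMh hP) D.lev_le ha
  have hEG : mlOpT (N0 ℓ Mh k P) ℓ k D.lev a * gmlT (N0 ℓ Mh k P) ℓ k D.lev a = 1 := mul_eq_one_comm.1 hGE
  rw [perLapT_eq_mlOpT_sub (N0 ℓ Mh k P) ℓ k D.lev a, Matrix.sub_mul, hEG]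

end Averaging

/-! ## §2 Proposition 2.2, sixth entry, for the genuine `k`-level operator on the torus -/

section Prop22

variable {ℓ Mh k R : ℕ} {P : Fin (d + 1) → ℕ}

/-- **[B6] PROPOSITION 2.2, SIXTH ENTRY OF (2.67) (`Δ^ηG′λ`), FOR THE GENUINE `k`-LEVEL OPERATOR `G′ = Δ′_a^{−1}` ON
THE TORUS `T_η`**: there are `δ₀, C, M₀ > 0` and `N₀ ≥ 1` (functions of `d`, `ℓ` and the windows — not of the torus)
such that for EVERY number of levels `k`, `M_h ≥ 3` with `L·M_h ≥ M₀`, `R ≥ 2L` with `RM ≥ N₀ + 1`, torus size `P`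
(`P_μ ≥ 4`), nested family `D` of domains of the torus (2.1)–(2.2), weights `a_i ∈ [a₋, a₊]`, `c_i ∈ [c₋, c₊]` with
`a_{i+1} = aNext ℓ a_i c_i`: `|((−Δ_T)G′λ)(x)| ≤ C·e^{−½δ₀d_T(y,y′)}·|λ|` for `x ∈ B^j(y)`, `y ∈ Λ_j`,
`supp λ ⊂ B^{j′}(y′)` (`HasMajorant` of `(−Δ_T)G′` on `geomT D`, print's factor «1») — from the first entry on the torus
(file T4 `prop22_first_multiLevelTorus`) and `(−Δ_T)G′ = 1 − Q′*aQ′G′` with the box lineage's row bound of `Q′*aQ′`.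
[cite: Balaban1984PropagatorsII, Proposition 2.2 (2.67) p.234 (sixth entry), (2.13)–(2.14) p.225, p.224 (Ω₁ = T_η admitted)] -/
theorem prop22_sixth_multiLevelTorus (d ℓ : ℕ) (hℓ : 1 ≤ ℓ) (aminus aplus a2minus a2plus : ℝ) (ha : 0 < aminus)
    (ha2 : 0 < a2minus) :
    ∃ δ₀ C M₀ : ℝ, ∃ N₀ : ℕ, 0 < δ₀ ∧ 0 < C ∧ 0 < M₀ ∧ 0 < N₀ ∧
      ∀ (k Mh R : ℕ), 3 ≤ Mh → M₀ ≤ ((ℓ : ℝ) + 1) * Mh → 2 * (ℓ + 1) ≤ R → N₀ + 1 ≤ R * ((ℓ + 1) * Mh) →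
      ∀ (P : Fin (d + 1) → ℕ) (hP : ∀ μ, 1 ≤ P μ) (hP4 : ∀ μ, 4 ≤ P μ) (D : TDomains d ℓ Mh k P R) (a c : ℕ → ℝ),
        (∀ i, aminus ≤ a i ∧ a i ≤ aplus) → (∀ i, a2minus ≤ c i ∧ c i ≤ a2plus) →
        (∀ i, a (i + 1) = aNext ℓ (a i) (c i)) →
        HasMajorant (g := geomT D) (blkOf D.toDomains)
          (Matrix.toLin' (perLapT (N0 ℓ Mh k P) * gmlT (N0 ℓ Mh k P) ℓ k D.lev a))
          (fun y y' => C * Real.exp (-(δ₀ / 2 * (geomT D).dist y y'))) := by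
  obtain ⟨δ₀, C, M₀, N₀, hδ₀, hC, hM₀, hN₀, hfirst⟩ :=
    prop22_first_multiLevelTorus d ℓ hℓ aminus aplus a2minus a2plus ha ha2
  refine ⟨δ₀, |aplus| * C + 1, M₀, N₀, hδ₀, by positivity, hM₀, hN₀, ?_⟩
  intro k Mh R hMh hM hR hRM P hP hP4 D a c haw hcw hac y' lam B hlam x
  have hMh1 : 1 ≤ Mh := le_trans (by norm_num) hMh
  have hG := hfirst k Mh R hMh hM hR hRM P hP hP4 D a c haw hcw hac
  have hapos : ∀ j, 0 < a j := fun j => lt_of_lt_of_le ha (haw j).1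
  obtain ⟨-, hrefl, hdnn⟩ := triangle_refl_nonneg_T D hMh1 hP
  have hB0 : 0 ≤ B := hlam.nonneg
  rw [Matrix.toLin'_apply, perLapT_mul_gmlT D hP hMh1 hapos, Matrix.sub_mulVec, Matrix.one_mulVec, Pi.sub_apply,
    ← Matrix.mulVec_mulVec]
  set e0 : ℝ := Real.exp (-(δ₀ / 2 * (geomT D).dist (blkOf D.toDomains x) y')) with he0
  have he0pos : 0 < e0 := Real.exp_pos _
  -- the source term `λ(x)`: supported in the block `y′`, where `d_T(y′,y′) = 0`
  have hlamx : |lam x| ≤ e0 * B := by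
    by_cases hx : blkOf D.toDomains x = y'
    · have : e0 = 1 := by rw [he0, hx, hrefl, mul_zero, neg_zero, Real.exp_zero]
      rw [this, one_mul]; exact hlam.bound x hx
    · rw [hlam.off x hx, abs_zero]; positivity
  -- the averaging term: the first entry on the block of `x`, times `a_j(L^j)^{−2}`
  have hgz : ∀ z, blkOf D.toDomains z = blkOf D.toDomains x →
      |(gmlT (N0 ℓ Mh k P) ℓ k D.lev a *ᵥ lam) z| ≤ C * ((ℓ : ℝ) + 1) ^ (2 * D.lev x.1) * e0 * B := by
    intro z hz
    have h := hG y' lam B hlam z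
    rw [Matrix.toLin'_apply, hz] at h
    exact h
  have hV := vOp_mulVec_abs_le D.toDomains (fun j => (hapos j).le) _ x hgz
  have hax : a (D.lev x.1) ≤ |aplus| := (haw _).2.trans (le_abs_self _)
  have hLpow : (0 : ℝ) < (((ℓ : ℝ) + 1) ^ D.lev x.1) ^ 2 := by positivity
  have hV' : |(vOp (N0 ℓ Mh k P) ℓ k D.lev a *ᵥ (gmlT (N0 ℓ Mh k P) ℓ k D.lev a *ᵥ lam)) x|
      ≤ |aplus| * C * e0 * B := by
    refine hV.trans ?_
    have hsimp : a (D.lev x.1) * ((((ℓ : ℝ) + 1) ^ D.lev x.1) ^ 2)⁻¹ * (C * ((ℓ : ℝ) + 1) ^ (2 * D.lev x.1) * e0 * B)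
        = a (D.lev x.1) * (C * e0 * B) := by
      rw [pow_mul']
      field_simp
    rw [B6MultiLevelTorusOperatorL0.TDomains.toDomains_lev, hsimp]
    calc a (D.lev x.1) * (C * e0 * B) ≤ |aplus| * (C * e0 * B) :=
          mul_le_mul_of_nonneg_right hax (by positivity)
      _ = |aplus| * C * e0 * B := by ring
  calc |lam x - (vOp (N0 ℓ Mh k P) ℓ k D.lev a *ᵥ (gmlT (N0 ℓ Mh k P) ℓ k D.lev a *ᵥ lam)) x|
      ≤ |lam x| + |(vOp (N0 ℓ Mh k P) ℓ k D.lev a *ᵥ (gmlT (N0 ℓ Mh k P) ℓ k D.lev a *ᵥ lam)) x| := abs_sub _ _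
    _ ≤ e0 * B + |aplus| * C * e0 * B := add_le_add hlamx hV'
    _ = (|aplus| * C + 1) * e0 * B := by ring

end Prop22

end

end Literature.MathematicalPhysics.QuantumFieldTheory.Balaban1983to89.B6Prop22LapMultiLevelTorusL0
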